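import Literature.Topology.FourManifolds.OneHandlebodySymmFour
import Literature.Topology.FourManifolds.HandlebodySymmetricModels
import HarnessLib

/-!
# SYMMᴹ in every universe: discharge of
# `Literature.Topology.FourManifolds.exists_oneHandlebody_diffeoExtends_isOrientationReversing`

Topic `Literature/Topology/FourManifolds`; fact seat
`provefact-Literature.Topology.FourManifolds.exists_diffeomorph_comp_incl_eq` (Laudenbach–Poénaru's
extension theorem), DAG `FACT ⇐ NORM + UNIQ₄ + LEMMA2ᴹ + THMAᴹ + SYMMᴹ` of
`SPC4HandlesModelReduction.lean`.  `OneHandlebodySymmFour.lean` proves SYMMᴹ in universe `0`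
with the concrete models `{q(x, y) + z² + w² ≤ c} ⊂ ℝ⁴`; the named fact quantifies over
`V₀ : Type u`.  This file supplies the standard bridge and **proves the named fact outright**
(`Literature.Topology.FourManifolds.exists_oneHandlebody_diffeoExtends_isOrientationReversing_holds`):
lift the model along `ULift.{u}` (`ManifoldULift.lean`: the same charts, the canonical
diffeomorphism `ULift V ≅ V`, Morse data unchanged) together with its boundary datum
(`BoundaryData.ulift` of `HandlebodySymmetricModels.lean`: carrier `ULift ∂V`, inclusion
`up ∘ incl ∘ down`), its handle decomposition, an orientation, the boundary
diffeomorphism `ρ₁ = up ∘ ρ₀ ∘ down`, its extension, its orientation character (a conjugate of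
a diffeomorphism reversing every orientation reverses every orientation of a connected manifold,
`Diffeomorph.isOrientationReversing_conj_of_forall` — the general form of
`isOrientationReversing_conj` of `SPC4HandlesModelReduction.lean`), its fixed point and its action
on `π₁` (`FundamentalGroup.mapOfEq_conj` along `Homeomorph.ulift`).  Consequently h₃
(`exists_diffeoExtends_isOrientationReversing`) follows from NORM and UNIQ₄ alone, and the
Laudenbach–Poénaru fact from NORM, UNIQ₄, LEMMA2ᴹ, THMAᴹ, in every universe
(`exists_diffeoExtends_isOrientationReversing_of_norm_of_uniq`,
`exists_diffeomorph_comp_incl_eq_of_model'`).  Everything here is **proved**.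

## References

* F. Laudenbach, V. Poénaru, *A note on 4-dimensional handlebodies*, Bull. Soc. Math. France
  100 (1972), 337–344, §2, p. 342. [LaudenbachPoenaruBSMF1972]
* J. M. Lee, *Introduction to Smooth Manifolds*, 2nd ed. (2013), Ch. 1 (transport of smooth
  structures), Thm. 5.11 (boundaries). [LeeSmoothManifolds2013]
* M. W. Hirsch, *Differential Topology*, GTM 33 (1976), Ch. 4 §4. [HirschDT1976]
-/

open scoped Manifold ContDiff Topology
open Set Function

noncomputable section

namespace Literature.Topology.FourManifolds

universe u v

/-! ### §1 Conjugates of diffeomorphisms reversing every orientation -/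

section ConjGeneral

variable {E H H' : Type*} [NormedAddCommGroup E] [NormedSpace ℝ E] [TopologicalSpace H]
  [TopologicalSpace H'] {I : ModelWithCorners ℝ E H} {J : ModelWithCorners ℝ E H'}
  {X : Type*} [TopologicalSpace X] [ChartedSpace H X] [IsManifold I ∞ X]
  {Y : Type*} [TopologicalSpace Y] [ChartedSpace H' Y] [IsManifold J ∞ Y]

/-- **A conjugate of a diffeomorphism reversing every orientation reverses every orientation of
a connected manifold.**  If `r` reverses every smooth orientation of `Y` and `e : X ≅ Y` is a
diffeomorphism from a connected manifold (same model vector space), then `e⁻¹ ∘ r ∘ e`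
reverses every smooth orientation of `X`: it reverses the pull-back `e^* o₀` of
`o₀ = (e⁻¹)^* o` (`SmoothOrientation.comap`; `e`, `e⁻¹` preserve, `r` reverses, characters
multiply), and every orientation of the connected `X` is `± e^* o₀`
(`SmoothOrientation.eq_or_eq_neg_of_connectedSpace_holds`).  Hirsch, *Differential Topology*
(1976), §4.4 (general form of `isOrientationReversing_conj` of `SPC4HandlesModelReduction.lean`).
[cite: HirschDT1976, §4.4] -/
theorem _root_.Diffeomorph.isOrientationReversing_conj_of_forall [ConnectedSpace X]
    (e : X ≃ₘ⟮I, J⟯ Y) {r : Y ≃ₘ⟮J, J⟯ Y}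
    (hr : ∀ o₀ : SmoothOrientation J Y, r.IsOrientationReversing o₀ o₀)
    (o : SmoothOrientation I X) : ((e.trans r).trans e.symm).IsOrientationReversing o o := by
  have hn : (∞ : WithTop ℕ∞) ≠ 0 := by simp
  let o₀ := o.comap e.symm hn
  let o' := o₀.comap e hn
  have heo : e.IsOrientationPreserving o' o₀ := SmoothOrientation.isOrientationPreserving_comap o₀ e hn
  have hes : e.symm.IsOrientationPreserving o₀ o' :=
    Diffeomorph.IsOrientationPreserving.symm_holds heo hn
  have hes' : e.symm.IsOrientationPreserving (-o₀) (-o') := by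
    rw [Diffeomorph.IsOrientationPreserving, isOrientationPreserving_neg_neg_iff]
    exact hes
  have h12 : (e.trans r).IsOrientationPreserving o' (-o₀) :=
    Diffeomorph.IsOrientationPreserving.trans_holds heo (hr o₀) hn
  have hrev' : ((e.trans r).trans e.symm).IsOrientationReversing o' o' :=
    Diffeomorph.IsOrientationPreserving.trans_holds h12 hes' hn
  rcases SmoothOrientation.eq_or_eq_neg_of_connectedSpace_holds o' o with h | h
  · rw [h]; exact hrev'
  · rw [h]; exact (isOrientationPreserving_neg_neg_iff o' (-o') _).mpr hrev'

end ConjGeneral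

/-! ### §2 Lifting boundary diffeomorphisms and their extensions along `ULift` -/

namespace BoundaryData

variable {E H E₀ H₀ : Type*} [NormedAddCommGroup E] [NormedSpace ℝ E] [TopologicalSpace H]
  [NormedAddCommGroup E₀] [NormedSpace ℝ E₀] [TopologicalSpace H₀]
  {I : ModelWithCorners ℝ E H} {I₀ : ModelWithCorners ℝ E₀ H₀}
  {M : Type u} [TopologicalSpace M] [ChartedSpace H M] [IsManifold I ∞ M]

omit [IsManifold I ∞ M] in
/-- **Lifting a boundary diffeomorphism**: `ρ₁ = up ∘ ρ ∘ down` on `ULift ∂M`. [folklore] -/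
def uliftDiffeo (b : BoundaryData I M I₀) (ρ : b.carrier ≃ₘ⟮I₀, I₀⟯ b.carrier) :
    ULift.{v} b.carrier ≃ₘ⟮I₀, I₀⟯ ULift.{v} b.carrier :=
  ((ManifoldULift.diffeomorph.{v} I₀ b.carrier ∞).trans ρ).trans
    (ManifoldULift.diffeomorph.{v} I₀ b.carrier ∞).symm

omit [IsManifold I ∞ M] in
/-- `ρ₁ x = up (ρ (down x))` (definitional). [folklore] -/
@[simp] theorem uliftDiffeo_apply (b : BoundaryData I M I₀) (ρ : b.carrier ≃ₘ⟮I₀, I₀⟯ b.carrier)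
    (x : ULift.{v} b.carrier) : b.uliftDiffeo.{u, v} ρ x = ULift.up (ρ x.down) := rfl

/-- **Extendability lifts**: if `ρ` extends over `M` then `up ∘ ρ ∘ down` extends over
`ULift M` (by `up ∘ Φ ∘ down`). [folklore] -/
theorem DiffeoExtends.ulift {b : BoundaryData I M I₀} {ρ : b.carrier ≃ₘ⟮I₀, I₀⟯ b.carrier}
    (h : b.DiffeoExtends ρ) :
    (b.ulift : BoundaryData I (ULift.{v} M) I₀).DiffeoExtends (b.uliftDiffeo.{u, v} ρ) := by
  obtain ⟨Φ, hΦ⟩ := h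
  refine ⟨((ManifoldULift.diffeomorph.{v} I M ∞).trans Φ).trans
    (ManifoldULift.diffeomorph.{v} I M ∞).symm, funext fun x => ?_⟩
  have hx := congrFun hΦ x.down
  simp only [comp_apply] at hx
  simp only [comp_apply, ulift_incl, Diffeomorph.coe_trans, ManifoldULift.diffeomorph_apply,
    ManifoldULift.diffeomorph_symm_apply, hx]
  rfl

end BoundaryData

/-! ### §3 The named fact -/

/-- **SYMMᴹ holds: discharge of the named fact
`Literature.Topology.FourManifolds.exists_oneHandlebody_diffeoExtends_isOrientationReversing`**
(every universe).  For every `k`, lift the universe-`0` model of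
`exists_oneHandlebody_diffeoExtends_isOrientationReversing_zero` (`OneHandlebodySymmFour.lean`:
`{q(x, y) + z² + w² ≤ c} ⊂ ℝ⁴`, the reflection `w ↦ -w`, the base point `(u₀, 0, 0)`) along
`ULift.{u}`: the manifold structure, compactness, connectedness, Hausdorffness and second
countability (`ManifoldULift.lean`, Mathlib), the handle decomposition
(`ManifoldULift.hasHandleDecomposition`), orientability (`ManifoldULift.isOrientable`), the
boundary datum (`BoundaryData.ulift`, all three from `HandlebodySymmetricModels.lean`), the boundary diffeomorphism `up ∘ ρ₀ ∘ down` and its extension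
(`BoundaryData.DiffeoExtends.ulift`), its reversal of every orientation of the connected boundary
(`Diffeomorph.isOrientationReversing_conj_of_forall`; the boundary of the model is connected,
`connectedSpace_boundary_of_isHandlebodyOfIndexLE_one_holds`), the fixed point `up z₀`, and
the triviality on `π₁` (`FundamentalGroup.mapOfEq_conj` along `Homeomorph.ulift`).
Cf. Laudenbach–Poénaru (1972), §2, p. 342, diagram (5). [folklore] -/
theorem exists_oneHandlebody_diffeoExtends_isOrientationReversing_holds :
    exists_oneHandlebody_diffeoExtends_isOrientationReversing.{u} := by
  intro k
  obtain ⟨V₀, _, _, _, _, _, _, _, b₀, ρ₀, hk₀, ho₀, hext₀, hrev₀, z₀, hz₀, hπ₀⟩ :=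
    exists_oneHandlebody_diffeoExtends_isOrientationReversing_zero k
  -- the boundary of the model is connected
  haveI : ConnectedSpace b₀.carrier :=
    connectedSpace_boundary_of_isHandlebodyOfIndexLE_one_holds V₀
      (isHandlebodyOfIndexLE_one_of_hasHandleDecomposition_handleCount_one hk₀) ho₀ b₀
  set D : ULift.{u} b₀.carrier ≃ₘ⟮𝓡 3, 𝓡 3⟯ b₀.carrier :=
    ManifoldULift.diffeomorph (𝓡 3) b₀.carrier ∞ with hD
  set ρ₁ : ULift.{u} b₀.carrier ≃ₘ⟮𝓡 3, 𝓡 3⟯ ULift.{u} b₀.carrier := b₀.uliftDiffeo ρ₀ with hρ₁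
  have hfix : ρ₁ (ULift.up z₀) = ULift.up z₀ := by
    rw [hρ₁, BoundaryData.uliftDiffeo_apply]
    exact congrArg ULift.up hz₀
  have hext₁ : (b₀.ulift : BoundaryData (𝓡∂ 4) (ULift.{u} V₀) (𝓡 3)).DiffeoExtends ρ₁ := hext₀.ulift
  refine ⟨ULift.{u} V₀, inferInstance, inferInstance, inferInstance, inferInstance, inferInstance,
    inferInstance, inferInstance, b₀.ulift, ρ₁,
    ManifoldULift.hasHandleDecomposition hk₀, ManifoldULift.isOrientable ho₀,
    hext₁, ?_, ULift.up z₀, hfix, fun a => ?_⟩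
  · -- reverses every orientation of the (connected) lifted boundary
    intro o
    rw [hρ₁]
    exact Diffeomorph.isOrientationReversing_conj_of_forall D hrev₀ o
  · -- acts trivially on `π₁`: conjugate by the homeomorphism `ULift ∂V₀ ≃ₜ ∂V₀`
    set e : ULift.{u} b₀.carrier ≃ₜ b₀.carrier := Homeomorph.ulift with he
    have key := FundamentalGroup.mapOfEq_conj e (rfl : e (ULift.up z₀) = z₀)
      (⟨ρ₁, ρ₁.continuous⟩ : C(ULift.{u} b₀.carrier, ULift.{u} b₀.carrier))
      (⟨ρ₀, ρ₀.continuous⟩ : C(b₀.carrier, b₀.carrier)) hfix hz₀ (fun p => rfl) a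
    exact (Homeomorph.fundamentalGroupCongr _ rfl).injective (key.symm.trans (hπ₀ _))

/-- **h₃ from NORM and UNIQ₄ alone** (every universe): with SYMMᴹ discharged, the named fact
`Literature.Topology.FourManifolds.exists_diffeoExtends_isOrientationReversing` (an
orientation-reversing, `π₁`-trivial, extendable diffeomorphism of the boundary of every compact
connected orientable `4`-dimensional `1`-handlebody) follows from the normal form NORM and the
classification UNIQ₄ (`exists_diffeoExtends_isOrientationReversing_of_model`). [folklore] -/
theorem exists_diffeoExtends_isOrientationReversing_of_norm_of_uniq
    (hN : exists_hasHandleDecomposition_handleCount_one.{u})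
    (hU : nonempty_diffeomorph_of_hasHandleDecomposition_handleCount_one.{u}) :
    exists_diffeoExtends_isOrientationReversing.{u} :=
  exists_diffeoExtends_isOrientationReversing_of_model hN hU
    exists_oneHandlebody_diffeoExtends_isOrientationReversing_holds

/-- **The Laudenbach–Poénaru fact from four named facts** (every universe): NORM, UNIQ₄,
LEMMA2ᴹ and THMAᴹ imply `Literature.Topology.FourManifolds.exists_diffeomorph_comp_incl_eq`,
SYMMᴹ being discharged (`exists_diffeomorph_comp_incl_eq_of_model`).
[cite: LaudenbachPoenaruBSMF1972, §2, pp. 339–342] -/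
theorem exists_diffeomorph_comp_incl_eq_of_model'
    (hN : exists_hasHandleDecomposition_handleCount_one.{u})
    (hU : nonempty_diffeomorph_of_hasHandleDecomposition_handleCount_one.{u})
    (hL : exists_oneHandlebody_laudenbachPoenaru_exists_diffeoExtends_mapOfEq_eq.{u})
    (hT : exists_oneHandlebody_laudenbachPoenaru_diffeoExtends_of_isOrientationPreserving.{u}) :
    exists_diffeomorph_comp_incl_eq.{u} :=
  exists_diffeomorph_comp_incl_eq_of_model hN hU hL hT
    exists_oneHandlebody_diffeoExtends_isOrientationReversing_holds

end Literature.Topology.FourManifolds
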